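import Mathlib
import HarnessLib
import Summits.Ventures.LatticeQCDFlow.Exactness.NCMCGeneralSpacePathIMH
import Summits.Ventures.LatticeQCDFlow.Exactness.NCMCGeneralSpaceTempered

/-!
# Dissipation on a general state space: the second law, the population ESS, and the bound of one lane by the other

HONEST FRAMING: exact (Metropolis-corrected) sampling algorithms for lattice gauge theory;
figures of merit are autocorrelation/cost numbers at stated couplings and volumes; no
continuum-physics claim.

Venture `LatticeQCDFlow` (cell pub-lqcd), topic `Exactness`; FANOUT row 13 (`eng-snf`, GEN-10).
NEW WORK of the cell (general measure theory, elementary), not a published result; nothing is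
cited as a fact (C. Jarzynski, Phys. Rev. Lett. 78 (1997) 2690; G. E. Crooks 1998/2000;
C. H. Bennett, J. Comput. Phys. 22 (1976) 245 named only).  General-state-space counterparts, for an
ARBITRARY Crooks pair of `NCMCGeneralSpace.lean` (stochastic steps with their adjoints,
Jacobian-charged bijective layers, concatenations — `NCMCGeneralSpaceSteps.lean`), of the
finite-space statements of row 13's `BennettAcceptanceRatio.lean`
(`essPop_eq_inv_dissipation`, `exp_neg_two_dissipation_eq_reverse`,
`essPop_le_exp_neg_reverse_dissipation`) and of the second law of `JarzynskiFinite.lean`; this was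
the item "population ESS ≤ e^{−⟨W_d⟩_rev} on general spaces" of the GEN-9 NOT-TYPED list.

## Setting and content

A Crooks pair `(κF, κR, s, e, W)` from `ν₀` to `ν₁` (measurable `Ω`, records `E`); the normalised
record laws `P_F = fwdPathLaw ν₀ κF = (ν₀ Ω)⁻¹ • (ν₀ ∘ κF)` (forward, from prior equilibrium) and
`P_R = fwdPathLaw ν₁ κR = (ν₁ Ω)⁻¹ • (ν₁ ∘ κR)` (reverse, from target equilibrium); the free-energy
difference is the real number `ΔF` with `e^{−ΔF} = Z₁/Z₀ = (ν₀ Ω)⁻¹ ν₁ Ω` (hypothesis `hΔF`;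
`exp_neg_freeEnergyDiff` exhibits it as `log Z₀ − log Z₁`).  The reverse protocol's work on a record
is `−W` and its free-energy difference `−ΔF`, so its dissipated work is `ΔF − W`.

* `lintegral_exp_neg_two_work` — `∫ e^{−2W} d(ν₀∘κF) = ∫ e^{−W} d(ν₁∘κR)` (Crooks with `g = e^{−W}`);
  `lintegral_exp_work_rev` — reverse Jarzynski `∫ e^{+W} d(ν₁∘κR) = ν₀ Ω` (the pair read
  backwards, `CrooksPair.symm`).
* `integral_exp_neg_work` / `integrable_exp_neg_work` — Jarzynski as a real expectation,
  `E_{P_F}[e^{−W}] = Z₁/Z₀`, the weight being `P_F`-integrable with no assumption on `W`;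
  `integral_exp_neg_two_work` — `E_{P_F}[e^{−2W}] = (Z₁/Z₀) · E_{P_R}[e^{−W}]`.
* **Second law, both lanes** (`Jensen`): `ΔF ≤ E_{P_F}[W]` (`freeEnergyDiff_le_integral_work`) and
  `E_{P_R}[W] ≤ ΔF` (`integral_work_rev_le_freeEnergyDiff`), each under integrability of `W` for
  its own lane — the two one-sided mean works BRACKET `ΔF` (`integral_work_rev_le_integral_work`).
* **Population Kish ESS of the Jarzynski weights** `ESS_F = (E_{P_F}[e^{−W}])² / E_{P_F}[e^{−2W}]`:
  `essPop_eq` (`= (Z₁/Z₀) / E_{P_R}[e^{−W}]`), `essPop_eq_inv_dissipation`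
  (`= 1 / E_{P_F}[e^{−2(W−ΔF)}]`, row 13's "ESS = 1/⟨e^{−2W_d}⟩" diagnostic),
  `essPop_eq_inv_rev` (`= 1 / E_{P_R}[e^{ΔF−W}]`: the inverse FIRST exponential moment of the
  reverse lane's dissipated work), `essPop_le_one`.
* **`essPop_le_exp_neg_rev_dissipation`** — `ESS_F ≤ exp(−E_{P_R}[ΔF − W])`: each lane's asymptotic
  efficiency is bounded by the OTHER lane's mean dissipated work (Jensen); stated with Mathlib's
  Bochner mean, so that when `W` is not `P_R`-integrable the exponent is `0` by convention and the
  bound is the trivial `ESS_F ≤ 1` — the theorem therefore carries no integrability hypothesis;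
  `essPop_rev_le_exp_neg_fwd_dissipation` is the same statement for the pair read backwards.

Nothing is claimed about any VALUE of an ESS or a mean work for a concrete protocol.
-/

namespace Summit.Ventures.LatticeQCDFlow.Exactness.GeneralNCMC

open MeasureTheory ProbabilityTheory Set Filter
open scoped ENNReal

variable {Ω E : Type*} [MeasurableSpace Ω] [MeasurableSpace E]

/-! ## A general-purpose Cauchy–Schwarz fact -/

/-- **`(∫ w dμ)² ≤ ∫ w² dμ` for a probability law**, in the form `(∫ w)² / ∫ w² ≤ 1` with Mathlib's
conventions (`Var ≥ 0` when `w ∈ L²`; otherwise the Bochner `∫ w² = 0` and the quotient is `0`). -/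
theorem sq_integral_div_integral_sq_le_one {α : Type*} [MeasurableSpace α] {μ : Measure α}
    [IsProbabilityMeasure μ] {w : α → ℝ} (hw : AEStronglyMeasurable w μ) :
    (∫ x, w x ∂μ) ^ 2 / ∫ x, w x ^ 2 ∂μ ≤ 1 := by
  by_cases hL : MemLp w 2 μ
  · have hv := variance_eq_sub hL
    have hnn := variance_nonneg w μ
    have hle : (∫ x, w x ∂μ) ^ 2 ≤ ∫ x, w x ^ 2 ∂μ := by
      have : (fun x => w x ^ 2) = w ^ 2 := by funext x; simp
      rw [this]; linarith
    exact div_le_one_of_le₀ hle ((sq_nonneg _).trans hle)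
  · rw [integral_undef (mt (memLp_two_iff_integrable_sq hw).2 hL), div_zero]
    exact zero_le_one

namespace CrooksPair

variable {ν₀ ν₁ : Measure Ω} {κF κR : Kernel Ω E} {s e : E → Ω} {W : E → ℝ}

/-! ## Exponential moments: Crooks with `g = e^{−W}`, and the pair read backwards -/

/-- **Second exponential moment forward = first exponential moment reverse**:
`∫ e^{−2W} d(ν₀ ∘ κF) = ∫ e^{−W} d(ν₁ ∘ κR)` (Crooks' identity for expectations with `g = e^{−W}`). -/
theorem lintegral_exp_neg_two_work (h : CrooksPair ν₀ ν₁ κF κR s e W) :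
    ∫⁻ ε, ENNReal.ofReal (Real.exp (-(2 * W ε))) ∂(ν₀.bind κF) =
      ∫⁻ ε, ENNReal.ofReal (Real.exp (-W ε)) ∂(ν₁.bind κR) := by
  have hm : Measurable fun ε => ENNReal.ofReal (Real.exp (-W ε)) :=
    (Real.measurable_exp.comp h.measurable_W.neg).ennreal_ofReal
  rw [← h.lintegral_mul_exp_neg_work hm]
  refine lintegral_congr fun ε => ?_
  rw [← ENNReal.ofReal_mul (Real.exp_pos _).le, ← Real.exp_add]
  congr 2
  ring

/-- **Reverse Jarzynski**: `∫ e^{+W} d(ν₁ ∘ κR) = ν₀(Ω) = Z₀` — Jarzynski's identity for the pair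
read backwards (`CrooksPair.symm`: work `−W`, from `ν₁` to `ν₀`). -/
theorem lintegral_exp_work_rev [IsMarkovKernel κF] (h : CrooksPair ν₀ ν₁ κF κR s e W) :
    ∫⁻ ε, ENNReal.ofReal (Real.exp (W ε)) ∂(ν₁.bind κR) = ν₀ univ := by
  have h1 := h.symm.lintegral_exp_neg_work
  simpa only [neg_neg] using h1

/-! ## Jarzynski as a real expectation under `P_F` -/

/-- **Jarzynski, real form**: `E_{P_F}[e^{−W}] = ((ν₀ Ω)⁻¹ ν₁ Ω).toReal = Z₁/Z₀` (no integrability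
assumption: the weight is non-negative). -/
theorem integral_exp_neg_work [IsMarkovKernel κR] (h : CrooksPair ν₀ ν₁ κF κR s e W) :
    ∫ ε, Real.exp (-W ε) ∂(fwdPathLaw ν₀ κF) = ((ν₀ univ)⁻¹ * ν₁ univ).toReal := by
  have hm : Measurable fun ε => Real.exp (-W ε) := Real.measurable_exp.comp h.measurable_W.neg
  rw [integral_eq_lintegral_of_nonneg_ae (Eventually.of_forall fun ε => (Real.exp_pos _).le)
      hm.aestronglyMeasurable]
  congr 1
  rw [fwdPathLaw, lintegral_smul_measure, h.lintegral_exp_neg_work, smul_eq_mul]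

/-- The Jarzynski weight `e^{−W}` is `P_F`-integrable as soon as `Z₀ ≠ 0` and `Z₁ < ∞`. -/
theorem integrable_exp_neg_work [IsFiniteMeasure ν₁] [IsMarkovKernel κR] (h0 : ν₀ univ ≠ 0)
    (h : CrooksPair ν₀ ν₁ κF κR s e W) :
    Integrable (fun ε => Real.exp (-W ε)) (fwdPathLaw ν₀ κF) := by
  have hm : Measurable fun ε => Real.exp (-W ε) := Real.measurable_exp.comp h.measurable_W.neg
  refine (lintegral_ofReal_ne_top_iff_integrable hm.aestronglyMeasurable
    (Eventually.of_forall fun ε => (Real.exp_pos _).le)).1 ?_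
  have hl : ∫⁻ ε, ENNReal.ofReal (Real.exp (-W ε)) ∂(fwdPathLaw ν₀ κF) = (ν₀ univ)⁻¹ * ν₁ univ := by
    rw [fwdPathLaw, lintegral_smul_measure, h.lintegral_exp_neg_work, smul_eq_mul]
  rw [hl]
  exact ENNReal.mul_ne_top (ENNReal.inv_ne_top.2 h0) (measure_ne_top ν₁ univ)

/-- **`E_{P_F}[e^{−2W}] = (Z₁/Z₀) · E_{P_R}[e^{−W}]`** (both sides `0` by Mathlib's convention when the
moment is infinite). -/
theorem integral_exp_neg_two_work [IsFiniteMeasure ν₁] (h1 : ν₁ univ ≠ 0)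
    (h : CrooksPair ν₀ ν₁ κF κR s e W) :
    ∫ ε, Real.exp (-(2 * W ε)) ∂(fwdPathLaw ν₀ κF) =
      ((ν₀ univ)⁻¹ * ν₁ univ).toReal * ∫ ε, Real.exp (-W ε) ∂(fwdPathLaw ν₁ κR) := by
  have hm2 : Measurable fun ε => Real.exp (-(2 * W ε)) :=
    Real.measurable_exp.comp (h.measurable_W.const_mul 2).neg
  have hm : Measurable fun ε => Real.exp (-W ε) := Real.measurable_exp.comp h.measurable_W.neg
  rw [integral_eq_lintegral_of_nonneg_ae (Eventually.of_forall fun ε => (Real.exp_pos _).le)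
      hm2.aestronglyMeasurable,
    integral_eq_lintegral_of_nonneg_ae (Eventually.of_forall fun ε => (Real.exp_pos _).le)
      hm.aestronglyMeasurable, ← ENNReal.toReal_mul]
  congr 1
  rw [fwdPathLaw, fwdPathLaw, lintegral_smul_measure, lintegral_smul_measure,
    h.lintegral_exp_neg_two_work, smul_eq_mul, smul_eq_mul, mul_assoc, ← mul_assoc (ν₁ univ),
    ENNReal.mul_inv_cancel h1 (measure_ne_top ν₁ univ), one_mul]

/-! ## The free-energy difference -/

/-- The free-energy difference `ΔF = log Z₀ − log Z₁` satisfies `e^{−ΔF} = Z₁/Z₀` (finite, non-zero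
partition functions). -/
theorem exp_neg_freeEnergyDiff [IsFiniteMeasure ν₀] [IsFiniteMeasure ν₁] (h0 : ν₀ univ ≠ 0)
    (h1 : ν₁ univ ≠ 0) :
    Real.exp (-(Real.log (ν₀ univ).toReal - Real.log (ν₁ univ).toReal)) =
      ((ν₀ univ)⁻¹ * ν₁ univ).toReal := by
  have hp0 : 0 < (ν₀ univ).toReal := ENNReal.toReal_pos h0 (measure_ne_top ν₀ univ)
  have hp1 : 0 < (ν₁ univ).toReal := ENNReal.toReal_pos h1 (measure_ne_top ν₁ univ)
  rw [neg_sub, Real.exp_sub, Real.exp_log hp1, Real.exp_log hp0, ENNReal.toReal_mul,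
    ENNReal.toReal_inv, div_eq_inv_mul]

/-- For finite non-zero partition functions `Z₁/Z₀` is a positive real, so `e^{−ΔF} > 0` fixes `ΔF`. -/
theorem toReal_ratio_pos [IsFiniteMeasure ν₀] [IsFiniteMeasure ν₁] (h0 : ν₀ univ ≠ 0)
    (h1 : ν₁ univ ≠ 0) : 0 < ((ν₀ univ)⁻¹ * ν₁ univ).toReal := by
  rw [ENNReal.toReal_mul, ENNReal.toReal_inv]
  exact mul_pos (inv_pos.2 (ENNReal.toReal_pos h0 (measure_ne_top ν₀ univ)))
    (ENNReal.toReal_pos h1 (measure_ne_top ν₁ univ))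

/-- With `e^{−ΔF} = Z₁/Z₀`: `e^{ΔF} = Z₀/Z₁ = (ν₁ Ω)⁻¹ ν₀ Ω` (the reverse pair's `e^{−ΔF_rev}`). -/
theorem exp_freeEnergyDiff [IsFiniteMeasure ν₀] [IsFiniteMeasure ν₁] (h0 : ν₀ univ ≠ 0)
    (h1 : ν₁ univ ≠ 0) {ΔF : ℝ} (hΔF : Real.exp (-ΔF) = ((ν₀ univ)⁻¹ * ν₁ univ).toReal) :
    Real.exp (-(-ΔF)) = ((ν₁ univ)⁻¹ * ν₀ univ).toReal := by
  have hp0 : 0 < (ν₀ univ).toReal := ENNReal.toReal_pos h0 (measure_ne_top ν₀ univ)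
  have hp1 : 0 < (ν₁ univ).toReal := ENNReal.toReal_pos h1 (measure_ne_top ν₁ univ)
  rw [neg_neg, ← neg_neg ΔF, Real.exp_neg, hΔF, ENNReal.toReal_mul, ENNReal.toReal_mul,
    ENNReal.toReal_inv, ENNReal.toReal_inv, mul_inv, inv_inv, mul_comm]

/-! ## The second law, both lanes -/

/-- **Second law, forward lane**: if `W` is `P_F`-integrable then `ΔF ≤ E_{P_F}[W]` — Jensen on
Jarzynski: `e^{−E[W]} ≤ E[e^{−W}] = e^{−ΔF}`. -/
theorem freeEnergyDiff_le_integral_work [IsFiniteMeasure ν₀] [IsFiniteMeasure ν₁]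
    [IsMarkovKernel κF] [IsMarkovKernel κR] (h0 : ν₀ univ ≠ 0)
    (h : CrooksPair ν₀ ν₁ κF κR s e W) {ΔF : ℝ}
    (hΔF : Real.exp (-ΔF) = ((ν₀ univ)⁻¹ * ν₁ univ).toReal)
    (hW : Integrable W (fwdPathLaw ν₀ κF)) : ΔF ≤ ∫ ε, W ε ∂(fwdPathLaw ν₀ κF) := by
  haveI := isProbabilityMeasure_fwdPathLaw ν₀ h0 κF
  have hWn : Integrable (fun ε => -W ε) (fwdPathLaw ν₀ κF) := hW.neg
  have hgi : Integrable (Real.exp ∘ fun ε => -W ε) (fwdPathLaw ν₀ κF) :=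
    h.integrable_exp_neg_work h0
  have hj := convexOn_exp.map_integral_le Real.continuous_exp.continuousOn isClosed_univ
    (Eventually.of_forall fun x => mem_univ _) hWn hgi
  have hrw : ∫ ε, Real.exp (-W ε) ∂(fwdPathLaw ν₀ κF) = Real.exp (-ΔF) := by
    rw [hΔF, ← h.integral_exp_neg_work]
  rw [hrw, integral_neg, Real.exp_le_exp] at hj
  linarith

/-- **Second law, reverse lane**: if `W` is `P_R`-integrable then `E_{P_R}[W] ≤ ΔF`, i.e. the reverse
protocol's mean dissipated work `E_{P_R}[ΔF − W]` is non-negative (the forward statement for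
`CrooksPair.symm`). -/
theorem integral_work_rev_le_freeEnergyDiff [IsFiniteMeasure ν₀] [IsFiniteMeasure ν₁]
    [IsMarkovKernel κF] [IsMarkovKernel κR] (h0 : ν₀ univ ≠ 0) (h1 : ν₁ univ ≠ 0)
    (h : CrooksPair ν₀ ν₁ κF κR s e W) {ΔF : ℝ}
    (hΔF : Real.exp (-ΔF) = ((ν₀ univ)⁻¹ * ν₁ univ).toReal)
    (hW : Integrable W (fwdPathLaw ν₁ κR)) : ∫ ε, W ε ∂(fwdPathLaw ν₁ κR) ≤ ΔF := by
  have hs := h.symm.freeEnergyDiff_le_integral_work h1 (exp_freeEnergyDiff h0 h1 hΔF) hW.neg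
  rw [integral_neg] at hs
  linarith

/-- **The two one-sided mean works bracket `ΔF`**: `E_{P_R}[W] ≤ ΔF ≤ E_{P_F}[W]` — in particular
`E_{P_R}[W] ≤ E_{P_F}[W]` for every protocol certified as a Crooks pair. -/
theorem integral_work_rev_le_integral_work [IsFiniteMeasure ν₀] [IsFiniteMeasure ν₁]
    [IsMarkovKernel κF] [IsMarkovKernel κR] (h0 : ν₀ univ ≠ 0) (h1 : ν₁ univ ≠ 0)
    (h : CrooksPair ν₀ ν₁ κF κR s e W) (hWF : Integrable W (fwdPathLaw ν₀ κF))
    (hWR : Integrable W (fwdPathLaw ν₁ κR)) :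
    ∫ ε, W ε ∂(fwdPathLaw ν₁ κR) ≤ ∫ ε, W ε ∂(fwdPathLaw ν₀ κF) :=
  (h.integral_work_rev_le_freeEnergyDiff h0 h1 (exp_neg_freeEnergyDiff h0 h1) hWR).trans
    (h.freeEnergyDiff_le_integral_work h0 (exp_neg_freeEnergyDiff h0 h1) hWF)

/-! ## The population ESS of the Jarzynski weights -/

/-- **Population Kish ESS of the forward Jarzynski weights in terms of the reverse lane**:
`(E_{P_F}[e^{−W}])² / E_{P_F}[e^{−2W}] = (Z₁/Z₀) / E_{P_R}[e^{−W}]`. -/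
theorem essPop_eq [IsFiniteMeasure ν₀] [IsFiniteMeasure ν₁] [IsMarkovKernel κR]
    (h0 : ν₀ univ ≠ 0) (h1 : ν₁ univ ≠ 0) (h : CrooksPair ν₀ ν₁ κF κR s e W) :
    (∫ ε, Real.exp (-W ε) ∂(fwdPathLaw ν₀ κF)) ^ 2 / ∫ ε, Real.exp (-(2 * W ε)) ∂(fwdPathLaw ν₀ κF) =
      ((ν₀ univ)⁻¹ * ν₁ univ).toReal / ∫ ε, Real.exp (-W ε) ∂(fwdPathLaw ν₁ κR) := by
  rw [h.integral_exp_neg_work, h.integral_exp_neg_two_work h1, sq,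
    mul_div_mul_left _ _ (toReal_ratio_pos h0 h1).ne']

/-- **`ESS_F = 1 / E_{P_F}[e^{−2 W_d}]`**, `W_d = W − ΔF` the dissipated work (row 13's
"ESS = 1/⟨e^{−2W_d}⟩" diagnostic, `snf.estimators.ess_kish` in population). -/
theorem essPop_eq_inv_dissipation [IsFiniteMeasure ν₀] [IsFiniteMeasure ν₁] [IsMarkovKernel κR]
    (h0 : ν₀ univ ≠ 0) (h1 : ν₁ univ ≠ 0) (h : CrooksPair ν₀ ν₁ κF κR s e W) {ΔF : ℝ}
    (hΔF : Real.exp (-ΔF) = ((ν₀ univ)⁻¹ * ν₁ univ).toReal) :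
    (∫ ε, Real.exp (-W ε) ∂(fwdPathLaw ν₀ κF)) ^ 2 / ∫ ε, Real.exp (-(2 * W ε)) ∂(fwdPathLaw ν₀ κF) =
      1 / ∫ ε, Real.exp (-(2 * (W ε - ΔF))) ∂(fwdPathLaw ν₀ κF) := by
  have hr := toReal_ratio_pos (ν₀ := ν₀) (ν₁ := ν₁) h0 h1
  rw [h.integral_exp_neg_work, ← hΔF]
  have hsplit : ∀ ε, Real.exp (-(2 * (W ε - ΔF))) =
      (Real.exp (-ΔF) * Real.exp (-ΔF))⁻¹ * Real.exp (-(2 * W ε)) := fun ε => by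
    rw [← Real.exp_add, ← Real.exp_neg, ← Real.exp_add]
    congr 1
    ring
  simp_rw [hsplit]
  rw [integral_const_mul, sq, one_div, mul_inv, inv_inv, div_eq_mul_inv]

/-- **`ESS_F = 1 / E_{P_R}[e^{ΔF − W}]`** — the inverse FIRST exponential moment of the REVERSE lane's
dissipated work `ΔF − W` (`E_{P_F}[e^{−2W_d}] = E_{P_R}[e^{+(ΔF − W)}]`, Crooks). -/
theorem essPop_eq_inv_rev [IsFiniteMeasure ν₀] [IsFiniteMeasure ν₁] [IsMarkovKernel κR]
    (h0 : ν₀ univ ≠ 0) (h1 : ν₁ univ ≠ 0) (h : CrooksPair ν₀ ν₁ κF κR s e W) {ΔF : ℝ}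
    (hΔF : Real.exp (-ΔF) = ((ν₀ univ)⁻¹ * ν₁ univ).toReal) :
    (∫ ε, Real.exp (-W ε) ∂(fwdPathLaw ν₀ κF)) ^ 2 / ∫ ε, Real.exp (-(2 * W ε)) ∂(fwdPathLaw ν₀ κF) =
      1 / ∫ ε, Real.exp (ΔF - W ε) ∂(fwdPathLaw ν₁ κR) := by
  rw [h.essPop_eq h0 h1, ← hΔF]
  have hsplit : ∀ ε, Real.exp (ΔF - W ε) = (Real.exp (-ΔF))⁻¹ * Real.exp (-W ε) := fun ε => by
    rw [← Real.exp_neg, ← Real.exp_add]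
    congr 1
    ring
  simp_rw [hsplit]
  rw [integral_const_mul, one_div, mul_inv, inv_inv, div_eq_mul_inv]

/-- **`ESS_F ≤ 1`.** -/
theorem essPop_le_one [IsFiniteMeasure ν₀] [IsMarkovKernel κF] (h0 : ν₀ univ ≠ 0)
    (h : CrooksPair ν₀ ν₁ κF κR s e W) :
    (∫ ε, Real.exp (-W ε) ∂(fwdPathLaw ν₀ κF)) ^ 2 /
        ∫ ε, Real.exp (-(2 * W ε)) ∂(fwdPathLaw ν₀ κF) ≤ 1 := by
  haveI := isProbabilityMeasure_fwdPathLaw ν₀ h0 κF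
  have hsq : ∀ ε, Real.exp (-(2 * W ε)) = Real.exp (-W ε) ^ 2 := fun ε => by
    rw [sq, ← Real.exp_add]
    congr 1
    ring
  have hm : Measurable fun ε => Real.exp (-W ε) := Real.measurable_exp.comp h.measurable_W.neg
  simp_rw [hsq]
  exact sq_integral_div_integral_sq_le_one hm.aestronglyMeasurable

/-- **The forward ESS is bounded by the reverse mean dissipation**:
`ESS_F ≤ exp(−E_{P_R}[ΔF − W])`.  When `W` is `P_R`-integrable this is Jensen applied to
`essPop_eq_inv_rev` (and the exponent is `≤ 0` by `integral_work_rev_le_freeEnergyDiff`); when it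
is not, Mathlib's Bochner mean is `0` and the statement is `essPop_le_one`.  By the same theorem for
`CrooksPair.symm` the reverse lane's ESS is bounded by the forward mean dissipation: a two-sided
run certifies an upper bound on each lane's asymptotic efficiency from the other lane's `⟨W_d⟩`,
with no free-energy estimate. -/
theorem essPop_le_exp_neg_rev_dissipation [IsFiniteMeasure ν₀] [IsFiniteMeasure ν₁]
    [IsMarkovKernel κF] [IsMarkovKernel κR] (h0 : ν₀ univ ≠ 0) (h1 : ν₁ univ ≠ 0)
    (h : CrooksPair ν₀ ν₁ κF κR s e W) {ΔF : ℝ}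
    (hΔF : Real.exp (-ΔF) = ((ν₀ univ)⁻¹ * ν₁ univ).toReal) :
    (∫ ε, Real.exp (-W ε) ∂(fwdPathLaw ν₀ κF)) ^ 2 /
        ∫ ε, Real.exp (-(2 * W ε)) ∂(fwdPathLaw ν₀ κF) ≤
      Real.exp (-∫ ε, (ΔF - W ε) ∂(fwdPathLaw ν₁ κR)) := by
  haveI := isProbabilityMeasure_fwdPathLaw ν₁ h1 κR
  by_cases hW : Integrable W (fwdPathLaw ν₁ κR)
  · have hf : Integrable (fun ε => ΔF - W ε) (fwdPathLaw ν₁ κR) := (integrable_const ΔF).sub' hW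
    rw [h.essPop_eq_inv_rev h0 h1 hΔF]
    by_cases hi : Integrable (fun ε => Real.exp (ΔF - W ε)) (fwdPathLaw ν₁ κR)
    · -- Jensen in real form
      have hj := convexOn_exp.map_integral_le Real.continuous_exp.continuousOn isClosed_univ
        (Eventually.of_forall fun x => mem_univ _) hf hi
      have hpos : 0 < Real.exp (∫ ε, (ΔF - W ε) ∂(fwdPathLaw ν₁ κR)) := Real.exp_pos _
      rw [Real.exp_neg, one_div]
      exact inv_anti₀ hpos hj
    · rw [integral_undef hi, div_zero]
      exact (Real.exp_pos _).le
  · have hf : ¬ Integrable (fun ε => ΔF - W ε) (fwdPathLaw ν₁ κR) := fun hf => hW <| by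
      have := (integrable_const ΔF).sub' hf
      simpa using this
    rw [integral_undef hf, neg_zero, Real.exp_zero]
    exact h.essPop_le_one h0

/-- **The reverse ESS is bounded by the forward mean dissipation** (the previous theorem for the
pair read backwards): `(E_{P_R}[e^{W}])² / E_{P_R}[e^{2W}] ≤ exp(−E_{P_F}[W − ΔF])`. -/
theorem essPop_rev_le_exp_neg_fwd_dissipation [IsFiniteMeasure ν₀] [IsFiniteMeasure ν₁]
    [IsMarkovKernel κF] [IsMarkovKernel κR] (h0 : ν₀ univ ≠ 0) (h1 : ν₁ univ ≠ 0)
    (h : CrooksPair ν₀ ν₁ κF κR s e W) {ΔF : ℝ}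
    (hΔF : Real.exp (-ΔF) = ((ν₀ univ)⁻¹ * ν₁ univ).toReal) :
    (∫ ε, Real.exp (W ε) ∂(fwdPathLaw ν₁ κR)) ^ 2 /
        ∫ ε, Real.exp (2 * W ε) ∂(fwdPathLaw ν₁ κR) ≤
      Real.exp (-∫ ε, (W ε - ΔF) ∂(fwdPathLaw ν₀ κF)) := by
  have hs := h.symm.essPop_le_exp_neg_rev_dissipation h1 h0 (exp_freeEnergyDiff h0 h1 hΔF)
  simpa only [neg_neg, mul_neg, sub_neg_eq_add, neg_add_eq_sub] using hs

end CrooksPair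

end Summit.Ventures.LatticeQCDFlow.Exactness.GeneralNCMC
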